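import Summits.CriticalPhenomena.PercolationContinuityZ3.Theorems.PercNearOneGluingNoHeavyLowerTailThreePointProductFormFibreTreeVertex
import HarnessLib

/-!
# (P) on tree-like fibres, IV: vertex identities `Ga`, `Gb`, `G1` (Sahi programme, prover prim-sahi-p2 gen 59)

Support file (`--supports stmt-CriticalPhenomena-4575`, helper); continues part III (`…ThreePointProductFormFibreTreeVertex`, same gen, same statement
pattern with `(φS, φC) = (1,0), (0,1), (0,0)` and child factors `p+g`, `q+g`, `r+g`).  Standard axioms, no sorries, no named facts, no definitions.
Memo `run/shared/lean/prim/prim-sahi/FROM-prim-sahi-p2-gen59-ONE-STEP-LEMMA.md` §2, §8(2); `prim-sahi-p2/PROOF-E3.md` (68j), §69.  [this work] (gen 59).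
-/

namespace Summit.CriticalPhenomena.PercolationContinuityZ3.Theorems.ProductFormFibre

open Finset Literature.Probability.Percolation
open Summit.CriticalPhenomena.PercolationContinuityZ3.Theorems.ThreePointCPIClusterSwap (clusterFlip)

variable {V α : Type*}

section VertexFlat

variable [Fintype α] [DecidableEq α] [DecidableEq V] (ends : α → Sym2 V) (s c : V)
  (T : V → Prop) (ch : V → Finset V) (mQ : V → α → Bool) (Sv : V → V → Prop) (e : V → α) (Ms Mc : V → Finset α)

open Classical in
/-- **Vertex identity, `Ga`**: at a trunk vertex the statistic equals the scaled recursion product over the children. [this work] -/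
theorem vertex_Ga
    (hsc : s ≠ c) (hT : ∀ v, T v → v ≠ s ∧ v ≠ c)
    (hch : ∀ v, T v → ∀ u ∈ ch v, T u)
    (he : ∀ v, T v → ∀ u ∈ ch v, ends (e u) = s(v, u))
    (hMs : ∀ v, T v → ∀ m ∈ Ms v, ends m = s(v, s)) (hMc : ∀ v, T v → ∀ m ∈ Mc v, ends m = s(v, c))
    (hmQ : ∀ v, T v → ∀ l, (mQ v l = true ↔ (∃ u ∈ ch v, l = e u ∨ mQ u l = true) ∨ l ∈ Ms v ∨ l ∈ Mc v))
    (hSv1 : ∀ u, T u → Sv u u)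
    (hSv2 : ∀ u, T u → ∀ l, mQ u l = true → (∀ x ∈ ends l, Sv u x ∨ (x = s ∨ x = c)) ∧ (∃ x ∈ ends l, Sv u x))
    (hSv3 : ∀ u, T u → ∀ x, Sv u x → x ≠ s ∧ x ≠ c)
    (hSv4 : ∀ v, T v → ∀ u ∈ ch v, ∀ x, Sv u x → x ≠ v)
    (hSv5 : ∀ v, T v → ∀ u ∈ ch v, ∀ u' ∈ ch v, u ≠ u' → ∀ x, Sv u x → ¬ Sv u' x)
    (w : V) (hw : T w) :
    ((((univ.filter fun z : α → Bool =>
        (((¬ (openGraph (labelledOpen ends (fun y => z y && mQ w y))).Reachable s w ∧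
        ¬ (openGraph (labelledOpen ends (fun y => z y && mQ w y))).Reachable s c) ∧
        (¬ (openGraph (labelledOpen ends (fun y => z y && mQ w y))).Reachable c w ∧
        ¬ (openGraph (labelledOpen ends (fun y => z y && mQ w y))).Reachable c s)) ∧
        (¬ (openGraph (labelledOpen ends (fun l =>
          clusterFlip ends w (fun y => !(z y && mQ w y)) l && mQ w l))).Reachable c w ∧
        ¬ (openGraph (labelledOpen ends (fun l =>
          clusterFlip ends w (fun y => !(z y && mQ w y)) l && mQ w l))).Reachable c s))).card) : ℕ) : ℝ) =
    (((univ : Finset (α → Bool)).card : ℝ) ^ (1 + (Ms w).card + (Mc w).card) /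
      (((univ : Finset (α → Bool)).card : ℝ) ^ ((ch w).card + (Ms w).card + (Mc w).card) * 2 ^ ((ch w).card + (Ms w).card + (Mc w).card))) *
    (((1 : ℝ)) ^ (Ms w).card * ((0 : ℝ)) ^ (Mc w).card * ∏ u ∈ ch w, (((((univ.filter fun z : α → Bool =>
        (¬ (openGraph (labelledOpen ends (fun y => z y && mQ u y))).Reachable c u ∧
        ¬ (openGraph (labelledOpen ends (fun y => z y && mQ u y))).Reachable c s)).card) : ℕ) : ℝ) + (((univ.filter fun z : α → Bool =>
        (((¬ (openGraph (labelledOpen ends (fun y => z y && mQ u y))).Reachable s u ∧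
        ¬ (openGraph (labelledOpen ends (fun y => z y && mQ u y))).Reachable s c) ∧
        (¬ (openGraph (labelledOpen ends (fun y => z y && mQ u y))).Reachable c u ∧
        ¬ (openGraph (labelledOpen ends (fun y => z y && mQ u y))).Reachable c s)) ∧
        ¬ (openGraph (labelledOpen ends (fun l =>
          clusterFlip ends u (fun y => !(z y && mQ u y)) l && mQ u l))).Reachable c s)).card : ℕ) : ℝ))) := by
  obtain ⟨hws, hwc⟩ := hT w hw
  obtain ⟨hQP, hPT, hP, hQ⟩ := family_hyps (ends := ends) (s := s) (c := c) (T := T) (ch := ch) (mQ := mQ) (Sv := Sv) (e := e) (Ms := Ms) (Mc := Mc) hT hch he hMs hMc hSv1 hSv2 hSv3 hSv4 hSv5 w hw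
  have hfam := card_parallel_family_Ga ends s w c
    (fun j => Sum.elim (fun u => fun y => decide (y = e u) || mQ u y) (fun m => fun y => decide (y = m)) j)
    (fun j => Sum.elim (fun u => Sv u) (fun _ => fun _ => False) j)
    (Ne.symm hws) (Ne.symm hwc) hsc
    ((ch w).map ⟨Sum.inl, Sum.inl_injective⟩ ∪ (Ms w ∪ Mc w).map ⟨Sum.inr, Sum.inr_injective⟩) hQP hPT hP hQ
  have hM : ∀ y, decide (∃ j ∈ (ch w).map ⟨Sum.inl, Sum.inl_injective⟩ ∪ (Ms w ∪ Mc w).map ⟨Sum.inr, Sum.inr_injective⟩,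
      (fun j => Sum.elim (fun u => fun y => decide (y = e u) || mQ u y) (fun m => fun y => decide (y = m)) j) j y = true) = mQ w y :=
    fun y => unionMask_eq (T := T) (ch := ch) (mQ := mQ) (e := e) (Ms := Ms) (Mc := Mc) hmQ w hw y
  simp only [hM] at hfam
  have hMM := marks_disjoint (ends := ends) (s := s) (c := c) (T := T) (Ms := Ms) (Mc := Mc) hsc hT hMs hMc w hw
  obtain ⟨hsplit, hcard⟩ := prod_family (ch := ch) (mQ := mQ) (e := e) (Ms := Ms) (Mc := Mc) w (fun mk : α → Bool => (((univ.filter fun z : α → Bool =>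
        (((¬ (openGraph (labelledOpen ends (fun y => z y && mk y))).Reachable s w ∧
        ¬ (openGraph (labelledOpen ends (fun y => z y && mk y))).Reachable s c) ∧
        (¬ (openGraph (labelledOpen ends (fun y => z y && mk y))).Reachable c w ∧
        ¬ (openGraph (labelledOpen ends (fun y => z y && mk y))).Reachable c s)) ∧
        (¬ (openGraph (labelledOpen ends (fun l =>
          clusterFlip ends w (fun y => !(z y && mk y)) l && mk l))).Reachable c w ∧
        ¬ (openGraph (labelledOpen ends (fun l =>
          clusterFlip ends w (fun y => !(z y && mk y)) l && mk l))).Reachable c s))).card : ℕ) : ℝ)) hMM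
  have hfamR := congrArg (fun n : ℕ => (n : ℝ)) hfam
  simp only [Nat.cast_mul, Nat.cast_pow, Nat.cast_prod] at hfamR
  rw [hsplit, hcard] at hfamR
  -- the children: series pieces
  have hser : ∀ u ∈ ch w, ((((univ.filter fun z : α → Bool =>
        (((¬ (openGraph (labelledOpen ends (fun y => z y && (decide (y = e u) || mQ u y)))).Reachable s w ∧
        ¬ (openGraph (labelledOpen ends (fun y => z y && (decide (y = e u) || mQ u y)))).Reachable s c) ∧
        (¬ (openGraph (labelledOpen ends (fun y => z y && (decide (y = e u) || mQ u y)))).Reachable c w ∧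
        ¬ (openGraph (labelledOpen ends (fun y => z y && (decide (y = e u) || mQ u y)))).Reachable c s)) ∧
        (¬ (openGraph (labelledOpen ends (fun l =>
          clusterFlip ends w (fun y => !(z y && (decide (y = e u) || mQ u y))) l && (decide (l = e u) || mQ u l)))).Reachable c w ∧
        ¬ (openGraph (labelledOpen ends (fun l =>
          clusterFlip ends w (fun y => !(z y && (decide (y = e u) || mQ u y))) l && (decide (l = e u) || mQ u l)))).Reachable c s))).card) : ℕ) : ℝ) = (((((univ.filter fun z : α → Bool =>
        (¬ (openGraph (labelledOpen ends (fun y => z y && mQ u y))).Reachable c u ∧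
        ¬ (openGraph (labelledOpen ends (fun y => z y && mQ u y))).Reachable c s)).card) : ℕ) : ℝ) + (((univ.filter fun z : α → Bool =>
        (((¬ (openGraph (labelledOpen ends (fun y => z y && mQ u y))).Reachable s u ∧
        ¬ (openGraph (labelledOpen ends (fun y => z y && mQ u y))).Reachable s c) ∧
        (¬ (openGraph (labelledOpen ends (fun y => z y && mQ u y))).Reachable c u ∧
        ¬ (openGraph (labelledOpen ends (fun y => z y && mQ u y))).Reachable c s)) ∧
        ¬ (openGraph (labelledOpen ends (fun l =>
          clusterFlip ends u (fun y => !(z y && mQ u y)) l && mQ u l))).Reachable c s)).card : ℕ) : ℝ)) / 2 := by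
    intro u hu
    obtain ⟨hua, hQu, heQ⟩ := child_hyps (ends := ends) (s := s) (c := c) (T := T) (ch := ch) (mQ := mQ) (Sv := Sv) (e := e) hT hch he hSv1 hSv2 hSv4 w hw u hu
    have h2 := two_mul_card_series_Ga_mask ends s w c u (e u) (mQ u) (he w hw u hu) hua (Ne.symm hws) (Ne.symm hwc) hQu heQ
    have h2R := congrArg (fun n : ℕ => (n : ℝ)) h2
    push_cast at h2R
    linarith
  -- the marks
  have hmS : ∀ m ∈ Ms w, ((((univ.filter fun z : α → Bool =>
        (((¬ (openGraph (labelledOpen ends (fun y => z y && decide (y = m)))).Reachable s w ∧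
        ¬ (openGraph (labelledOpen ends (fun y => z y && decide (y = m)))).Reachable s c) ∧
        (¬ (openGraph (labelledOpen ends (fun y => z y && decide (y = m)))).Reachable c w ∧
        ¬ (openGraph (labelledOpen ends (fun y => z y && decide (y = m)))).Reachable c s)) ∧
        (¬ (openGraph (labelledOpen ends (fun l =>
          clusterFlip ends w (fun y => !(z y && decide (y = m))) l && decide (l = m)))).Reachable c w ∧
        ¬ (openGraph (labelledOpen ends (fun l =>
          clusterFlip ends w (fun y => !(z y && decide (y = m))) l && decide (l = m)))).Reachable c s))).card) : ℕ) : ℝ) = (((univ : Finset (α → Bool)).card : ℝ) / 2) * (1 : ℝ) := by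
    intro m hm
    have h2 := two_mul_card_markS_Ga ends s w c m (hMs w hw m hm) (Ne.symm hws) (Ne.symm hwc) hsc
    have h2R := congrArg (fun n : ℕ => (n : ℝ)) h2
    push_cast at h2R
    linarith
  have hmC : ∀ m ∈ Mc w, ((((univ.filter fun z : α → Bool =>
        (((¬ (openGraph (labelledOpen ends (fun y => z y && decide (y = m)))).Reachable s w ∧
        ¬ (openGraph (labelledOpen ends (fun y => z y && decide (y = m)))).Reachable s c) ∧
        (¬ (openGraph (labelledOpen ends (fun y => z y && decide (y = m)))).Reachable c w ∧
        ¬ (openGraph (labelledOpen ends (fun y => z y && decide (y = m)))).Reachable c s)) ∧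
        (¬ (openGraph (labelledOpen ends (fun l =>
          clusterFlip ends w (fun y => !(z y && decide (y = m))) l && decide (l = m)))).Reachable c w ∧
        ¬ (openGraph (labelledOpen ends (fun l =>
          clusterFlip ends w (fun y => !(z y && decide (y = m))) l && decide (l = m)))).Reachable c s))).card) : ℕ) : ℝ) = (((univ : Finset (α → Bool)).card : ℝ) / 2) * (0 : ℝ) := by
    intro m hm
    have h2 := two_mul_card_markC_Ga ends s w c m (hMc w hw m hm) (Ne.symm hws) (Ne.symm hwc) hsc
    have h2R := congrArg (fun n : ℕ => (n : ℝ)) h2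
    push_cast at h2R
    linarith
  rw [Finset.prod_congr rfl hser, Finset.prod_congr rfl hmS, Finset.prod_congr rfl hmC, Finset.prod_div_distrib,
    Finset.prod_const, Finset.prod_const, Finset.prod_const] at hfamR
  have hU : (0 : ℝ) < ((univ : Finset (α → Bool)).card : ℝ) := by exact_mod_cast Finset.card_pos.mpr Finset.univ_nonempty
  exact assemble_eq' _ _ _ _ _ _ _ _ hU hfamR

open Classical in
/-- **Vertex identity, `Gb`**: at a trunk vertex the statistic equals the scaled recursion product over the children. [this work] -/
theorem vertex_Gb
    (hsc : s ≠ c) (hT : ∀ v, T v → v ≠ s ∧ v ≠ c)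
    (hch : ∀ v, T v → ∀ u ∈ ch v, T u)
    (he : ∀ v, T v → ∀ u ∈ ch v, ends (e u) = s(v, u))
    (hMs : ∀ v, T v → ∀ m ∈ Ms v, ends m = s(v, s)) (hMc : ∀ v, T v → ∀ m ∈ Mc v, ends m = s(v, c))
    (hmQ : ∀ v, T v → ∀ l, (mQ v l = true ↔ (∃ u ∈ ch v, l = e u ∨ mQ u l = true) ∨ l ∈ Ms v ∨ l ∈ Mc v))
    (hSv1 : ∀ u, T u → Sv u u)
    (hSv2 : ∀ u, T u → ∀ l, mQ u l = true → (∀ x ∈ ends l, Sv u x ∨ (x = s ∨ x = c)) ∧ (∃ x ∈ ends l, Sv u x))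
    (hSv3 : ∀ u, T u → ∀ x, Sv u x → x ≠ s ∧ x ≠ c)
    (hSv4 : ∀ v, T v → ∀ u ∈ ch v, ∀ x, Sv u x → x ≠ v)
    (hSv5 : ∀ v, T v → ∀ u ∈ ch v, ∀ u' ∈ ch v, u ≠ u' → ∀ x, Sv u x → ¬ Sv u' x)
    (w : V) (hw : T w) :
    ((((univ.filter fun z : α → Bool =>
        (((¬ (openGraph (labelledOpen ends (fun y => z y && mQ w y))).Reachable s w ∧
        ¬ (openGraph (labelledOpen ends (fun y => z y && mQ w y))).Reachable s c) ∧
        (¬ (openGraph (labelledOpen ends (fun y => z y && mQ w y))).Reachable c w ∧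
        ¬ (openGraph (labelledOpen ends (fun y => z y && mQ w y))).Reachable c s)) ∧
        (¬ (openGraph (labelledOpen ends (fun l =>
          clusterFlip ends w (fun y => !(z y && mQ w y)) l && mQ w l))).Reachable s w ∧
        ¬ (openGraph (labelledOpen ends (fun l =>
          clusterFlip ends w (fun y => !(z y && mQ w y)) l && mQ w l))).Reachable s c))).card) : ℕ) : ℝ) =
    (((univ : Finset (α → Bool)).card : ℝ) ^ (1 + (Ms w).card + (Mc w).card) /
      (((univ : Finset (α → Bool)).card : ℝ) ^ ((ch w).card + (Ms w).card + (Mc w).card) * 2 ^ ((ch w).card + (Ms w).card + (Mc w).card))) *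
    (((0 : ℝ)) ^ (Ms w).card * ((1 : ℝ)) ^ (Mc w).card * ∏ u ∈ ch w, (((((univ.filter fun z : α → Bool =>
        (¬ (openGraph (labelledOpen ends (fun y => z y && mQ u y))).Reachable s u ∧
        ¬ (openGraph (labelledOpen ends (fun y => z y && mQ u y))).Reachable s c)).card) : ℕ) : ℝ) + (((univ.filter fun z : α → Bool =>
        (((¬ (openGraph (labelledOpen ends (fun y => z y && mQ u y))).Reachable s u ∧
        ¬ (openGraph (labelledOpen ends (fun y => z y && mQ u y))).Reachable s c) ∧
        (¬ (openGraph (labelledOpen ends (fun y => z y && mQ u y))).Reachable c u ∧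
        ¬ (openGraph (labelledOpen ends (fun y => z y && mQ u y))).Reachable c s)) ∧
        ¬ (openGraph (labelledOpen ends (fun l =>
          clusterFlip ends u (fun y => !(z y && mQ u y)) l && mQ u l))).Reachable c s)).card : ℕ) : ℝ))) := by
  obtain ⟨hws, hwc⟩ := hT w hw
  obtain ⟨hQP, hPT, hP, hQ⟩ := family_hyps (ends := ends) (s := s) (c := c) (T := T) (ch := ch) (mQ := mQ) (Sv := Sv) (e := e) (Ms := Ms) (Mc := Mc) hT hch he hMs hMc hSv1 hSv2 hSv3 hSv4 hSv5 w hw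
  have hfam := card_parallel_family_Gb ends s w c
    (fun j => Sum.elim (fun u => fun y => decide (y = e u) || mQ u y) (fun m => fun y => decide (y = m)) j)
    (fun j => Sum.elim (fun u => Sv u) (fun _ => fun _ => False) j)
    (Ne.symm hws) (Ne.symm hwc) hsc
    ((ch w).map ⟨Sum.inl, Sum.inl_injective⟩ ∪ (Ms w ∪ Mc w).map ⟨Sum.inr, Sum.inr_injective⟩) hQP hPT hP hQ
  have hM : ∀ y, decide (∃ j ∈ (ch w).map ⟨Sum.inl, Sum.inl_injective⟩ ∪ (Ms w ∪ Mc w).map ⟨Sum.inr, Sum.inr_injective⟩,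
      (fun j => Sum.elim (fun u => fun y => decide (y = e u) || mQ u y) (fun m => fun y => decide (y = m)) j) j y = true) = mQ w y :=
    fun y => unionMask_eq (T := T) (ch := ch) (mQ := mQ) (e := e) (Ms := Ms) (Mc := Mc) hmQ w hw y
  simp only [hM] at hfam
  have hMM := marks_disjoint (ends := ends) (s := s) (c := c) (T := T) (Ms := Ms) (Mc := Mc) hsc hT hMs hMc w hw
  obtain ⟨hsplit, hcard⟩ := prod_family (ch := ch) (mQ := mQ) (e := e) (Ms := Ms) (Mc := Mc) w (fun mk : α → Bool => (((univ.filter fun z : α → Bool =>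
        (((¬ (openGraph (labelledOpen ends (fun y => z y && mk y))).Reachable s w ∧
        ¬ (openGraph (labelledOpen ends (fun y => z y && mk y))).Reachable s c) ∧
        (¬ (openGraph (labelledOpen ends (fun y => z y && mk y))).Reachable c w ∧
        ¬ (openGraph (labelledOpen ends (fun y => z y && mk y))).Reachable c s)) ∧
        (¬ (openGraph (labelledOpen ends (fun l =>
          clusterFlip ends w (fun y => !(z y && mk y)) l && mk l))).Reachable s w ∧
        ¬ (openGraph (labelledOpen ends (fun l =>
          clusterFlip ends w (fun y => !(z y && mk y)) l && mk l))).Reachable s c))).card : ℕ) : ℝ)) hMM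
  have hfamR := congrArg (fun n : ℕ => (n : ℝ)) hfam
  simp only [Nat.cast_mul, Nat.cast_pow, Nat.cast_prod] at hfamR
  rw [hsplit, hcard] at hfamR
  -- the children: series pieces
  have hser : ∀ u ∈ ch w, ((((univ.filter fun z : α → Bool =>
        (((¬ (openGraph (labelledOpen ends (fun y => z y && (decide (y = e u) || mQ u y)))).Reachable s w ∧
        ¬ (openGraph (labelledOpen ends (fun y => z y && (decide (y = e u) || mQ u y)))).Reachable s c) ∧
        (¬ (openGraph (labelledOpen ends (fun y => z y && (decide (y = e u) || mQ u y)))).Reachable c w ∧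
        ¬ (openGraph (labelledOpen ends (fun y => z y && (decide (y = e u) || mQ u y)))).Reachable c s)) ∧
        (¬ (openGraph (labelledOpen ends (fun l =>
          clusterFlip ends w (fun y => !(z y && (decide (y = e u) || mQ u y))) l && (decide (l = e u) || mQ u l)))).Reachable s w ∧
        ¬ (openGraph (labelledOpen ends (fun l =>
          clusterFlip ends w (fun y => !(z y && (decide (y = e u) || mQ u y))) l && (decide (l = e u) || mQ u l)))).Reachable s c))).card) : ℕ) : ℝ) = (((((univ.filter fun z : α → Bool =>
        (¬ (openGraph (labelledOpen ends (fun y => z y && mQ u y))).Reachable s u ∧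
        ¬ (openGraph (labelledOpen ends (fun y => z y && mQ u y))).Reachable s c)).card) : ℕ) : ℝ) + (((univ.filter fun z : α → Bool =>
        (((¬ (openGraph (labelledOpen ends (fun y => z y && mQ u y))).Reachable s u ∧
        ¬ (openGraph (labelledOpen ends (fun y => z y && mQ u y))).Reachable s c) ∧
        (¬ (openGraph (labelledOpen ends (fun y => z y && mQ u y))).Reachable c u ∧
        ¬ (openGraph (labelledOpen ends (fun y => z y && mQ u y))).Reachable c s)) ∧
        ¬ (openGraph (labelledOpen ends (fun l =>
          clusterFlip ends u (fun y => !(z y && mQ u y)) l && mQ u l))).Reachable c s)).card : ℕ) : ℝ)) / 2 := by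
    intro u hu
    obtain ⟨hua, hQu, heQ⟩ := child_hyps (ends := ends) (s := s) (c := c) (T := T) (ch := ch) (mQ := mQ) (Sv := Sv) (e := e) hT hch he hSv1 hSv2 hSv4 w hw u hu
    have h2 := two_mul_card_series_Gb_mask ends s w c u (e u) (mQ u) (he w hw u hu) hua (Ne.symm hws) (Ne.symm hwc) hQu heQ
    have h2R := congrArg (fun n : ℕ => (n : ℝ)) h2
    push_cast at h2R
    linarith
  -- the marks
  have hmS : ∀ m ∈ Ms w, ((((univ.filter fun z : α → Bool =>
        (((¬ (openGraph (labelledOpen ends (fun y => z y && decide (y = m)))).Reachable s w ∧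
        ¬ (openGraph (labelledOpen ends (fun y => z y && decide (y = m)))).Reachable s c) ∧
        (¬ (openGraph (labelledOpen ends (fun y => z y && decide (y = m)))).Reachable c w ∧
        ¬ (openGraph (labelledOpen ends (fun y => z y && decide (y = m)))).Reachable c s)) ∧
        (¬ (openGraph (labelledOpen ends (fun l =>
          clusterFlip ends w (fun y => !(z y && decide (y = m))) l && decide (l = m)))).Reachable s w ∧
        ¬ (openGraph (labelledOpen ends (fun l =>
          clusterFlip ends w (fun y => !(z y && decide (y = m))) l && decide (l = m)))).Reachable s c))).card) : ℕ) : ℝ) = (((univ : Finset (α → Bool)).card : ℝ) / 2) * (0 : ℝ) := by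
    intro m hm
    have h2 := two_mul_card_markS_Gb ends s w c m (hMs w hw m hm) (Ne.symm hws) (Ne.symm hwc) hsc
    have h2R := congrArg (fun n : ℕ => (n : ℝ)) h2
    push_cast at h2R
    linarith
  have hmC : ∀ m ∈ Mc w, ((((univ.filter fun z : α → Bool =>
        (((¬ (openGraph (labelledOpen ends (fun y => z y && decide (y = m)))).Reachable s w ∧
        ¬ (openGraph (labelledOpen ends (fun y => z y && decide (y = m)))).Reachable s c) ∧
        (¬ (openGraph (labelledOpen ends (fun y => z y && decide (y = m)))).Reachable c w ∧
        ¬ (openGraph (labelledOpen ends (fun y => z y && decide (y = m)))).Reachable c s)) ∧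
        (¬ (openGraph (labelledOpen ends (fun l =>
          clusterFlip ends w (fun y => !(z y && decide (y = m))) l && decide (l = m)))).Reachable s w ∧
        ¬ (openGraph (labelledOpen ends (fun l =>
          clusterFlip ends w (fun y => !(z y && decide (y = m))) l && decide (l = m)))).Reachable s c))).card) : ℕ) : ℝ) = (((univ : Finset (α → Bool)).card : ℝ) / 2) * (1 : ℝ) := by
    intro m hm
    have h2 := two_mul_card_markC_Gb ends s w c m (hMc w hw m hm) (Ne.symm hws) (Ne.symm hwc) hsc
    have h2R := congrArg (fun n : ℕ => (n : ℝ)) h2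
    push_cast at h2R
    linarith
  rw [Finset.prod_congr rfl hser, Finset.prod_congr rfl hmS, Finset.prod_congr rfl hmC, Finset.prod_div_distrib,
    Finset.prod_const, Finset.prod_const, Finset.prod_const] at hfamR
  have hU : (0 : ℝ) < ((univ : Finset (α → Bool)).card : ℝ) := by exact_mod_cast Finset.card_pos.mpr Finset.univ_nonempty
  exact assemble_eq' _ _ _ _ _ _ _ _ hU hfamR

open Classical in
/-- **Vertex identity, `G1`**: at a trunk vertex the statistic equals the scaled recursion product over the children. [this work] -/
theorem vertex_G1
    (hsc : s ≠ c) (hT : ∀ v, T v → v ≠ s ∧ v ≠ c)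
    (hch : ∀ v, T v → ∀ u ∈ ch v, T u)
    (he : ∀ v, T v → ∀ u ∈ ch v, ends (e u) = s(v, u))
    (hMs : ∀ v, T v → ∀ m ∈ Ms v, ends m = s(v, s)) (hMc : ∀ v, T v → ∀ m ∈ Mc v, ends m = s(v, c))
    (hmQ : ∀ v, T v → ∀ l, (mQ v l = true ↔ (∃ u ∈ ch v, l = e u ∨ mQ u l = true) ∨ l ∈ Ms v ∨ l ∈ Mc v))
    (hSv1 : ∀ u, T u → Sv u u)
    (hSv2 : ∀ u, T u → ∀ l, mQ u l = true → (∀ x ∈ ends l, Sv u x ∨ (x = s ∨ x = c)) ∧ (∃ x ∈ ends l, Sv u x))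
    (hSv3 : ∀ u, T u → ∀ x, Sv u x → x ≠ s ∧ x ≠ c)
    (hSv4 : ∀ v, T v → ∀ u ∈ ch v, ∀ x, Sv u x → x ≠ v)
    (hSv5 : ∀ v, T v → ∀ u ∈ ch v, ∀ u' ∈ ch v, u ≠ u' → ∀ x, Sv u x → ¬ Sv u' x)
    (w : V) (hw : T w) :
    ((((univ.filter fun z : α → Bool =>
        (((¬ (openGraph (labelledOpen ends (fun y => z y && mQ w y))).Reachable s w ∧
        ¬ (openGraph (labelledOpen ends (fun y => z y && mQ w y))).Reachable s c) ∧
        (¬ (openGraph (labelledOpen ends (fun y => z y && mQ w y))).Reachable c w ∧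
        ¬ (openGraph (labelledOpen ends (fun y => z y && mQ w y))).Reachable c s)) ∧
        ((¬ (openGraph (labelledOpen ends (fun l =>
          clusterFlip ends w (fun y => !(z y && mQ w y)) l && mQ w l))).Reachable s w ∧
        ¬ (openGraph (labelledOpen ends (fun l =>
          clusterFlip ends w (fun y => !(z y && mQ w y)) l && mQ w l))).Reachable s c) ∧
        (¬ (openGraph (labelledOpen ends (fun l =>
          clusterFlip ends w (fun y => !(z y && mQ w y)) l && mQ w l))).Reachable c w ∧
        ¬ (openGraph (labelledOpen ends (fun l =>
          clusterFlip ends w (fun y => !(z y && mQ w y)) l && mQ w l))).Reachable c s)))).card) : ℕ) : ℝ) =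
    (((univ : Finset (α → Bool)).card : ℝ) ^ (1 + (Ms w).card + (Mc w).card) /
      (((univ : Finset (α → Bool)).card : ℝ) ^ ((ch w).card + (Ms w).card + (Mc w).card) * 2 ^ ((ch w).card + (Ms w).card + (Mc w).card))) *
    (((0 : ℝ)) ^ (Ms w).card * ((0 : ℝ)) ^ (Mc w).card * ∏ u ∈ ch w, (((((univ.filter fun z : α → Bool =>
        ((¬ (openGraph (labelledOpen ends (fun y => z y && mQ u y))).Reachable s u ∧
        ¬ (openGraph (labelledOpen ends (fun y => z y && mQ u y))).Reachable s c) ∧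
        (¬ (openGraph (labelledOpen ends (fun y => z y && mQ u y))).Reachable c u ∧
        ¬ (openGraph (labelledOpen ends (fun y => z y && mQ u y))).Reachable c s))).card) : ℕ) : ℝ) + (((univ.filter fun z : α → Bool =>
        (((¬ (openGraph (labelledOpen ends (fun y => z y && mQ u y))).Reachable s u ∧
        ¬ (openGraph (labelledOpen ends (fun y => z y && mQ u y))).Reachable s c) ∧
        (¬ (openGraph (labelledOpen ends (fun y => z y && mQ u y))).Reachable c u ∧
        ¬ (openGraph (labelledOpen ends (fun y => z y && mQ u y))).Reachable c s)) ∧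
        ¬ (openGraph (labelledOpen ends (fun l =>
          clusterFlip ends u (fun y => !(z y && mQ u y)) l && mQ u l))).Reachable c s)).card : ℕ) : ℝ))) := by
  obtain ⟨hws, hwc⟩ := hT w hw
  obtain ⟨hQP, hPT, hP, hQ⟩ := family_hyps (ends := ends) (s := s) (c := c) (T := T) (ch := ch) (mQ := mQ) (Sv := Sv) (e := e) (Ms := Ms) (Mc := Mc) hT hch he hMs hMc hSv1 hSv2 hSv3 hSv4 hSv5 w hw
  have hfam := card_parallel_family_G1 ends s w c
    (fun j => Sum.elim (fun u => fun y => decide (y = e u) || mQ u y) (fun m => fun y => decide (y = m)) j)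
    (fun j => Sum.elim (fun u => Sv u) (fun _ => fun _ => False) j)
    (Ne.symm hws) (Ne.symm hwc) hsc
    ((ch w).map ⟨Sum.inl, Sum.inl_injective⟩ ∪ (Ms w ∪ Mc w).map ⟨Sum.inr, Sum.inr_injective⟩) hQP hPT hP hQ
  have hM : ∀ y, decide (∃ j ∈ (ch w).map ⟨Sum.inl, Sum.inl_injective⟩ ∪ (Ms w ∪ Mc w).map ⟨Sum.inr, Sum.inr_injective⟩,
      (fun j => Sum.elim (fun u => fun y => decide (y = e u) || mQ u y) (fun m => fun y => decide (y = m)) j) j y = true) = mQ w y :=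
    fun y => unionMask_eq (T := T) (ch := ch) (mQ := mQ) (e := e) (Ms := Ms) (Mc := Mc) hmQ w hw y
  simp only [hM] at hfam
  have hMM := marks_disjoint (ends := ends) (s := s) (c := c) (T := T) (Ms := Ms) (Mc := Mc) hsc hT hMs hMc w hw
  obtain ⟨hsplit, hcard⟩ := prod_family (ch := ch) (mQ := mQ) (e := e) (Ms := Ms) (Mc := Mc) w (fun mk : α → Bool => (((univ.filter fun z : α → Bool =>
        (((¬ (openGraph (labelledOpen ends (fun y => z y && mk y))).Reachable s w ∧
        ¬ (openGraph (labelledOpen ends (fun y => z y && mk y))).Reachable s c) ∧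
        (¬ (openGraph (labelledOpen ends (fun y => z y && mk y))).Reachable c w ∧
        ¬ (openGraph (labelledOpen ends (fun y => z y && mk y))).Reachable c s)) ∧
        ((¬ (openGraph (labelledOpen ends (fun l =>
          clusterFlip ends w (fun y => !(z y && mk y)) l && mk l))).Reachable s w ∧
        ¬ (openGraph (labelledOpen ends (fun l =>
          clusterFlip ends w (fun y => !(z y && mk y)) l && mk l))).Reachable s c) ∧
        (¬ (openGraph (labelledOpen ends (fun l =>
          clusterFlip ends w (fun y => !(z y && mk y)) l && mk l))).Reachable c w ∧
        ¬ (openGraph (labelledOpen ends (fun l =>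
          clusterFlip ends w (fun y => !(z y && mk y)) l && mk l))).Reachable c s)))).card : ℕ) : ℝ)) hMM
  have hfamR := congrArg (fun n : ℕ => (n : ℝ)) hfam
  simp only [Nat.cast_mul, Nat.cast_pow, Nat.cast_prod] at hfamR
  rw [hsplit, hcard] at hfamR
  -- the children: series pieces
  have hser : ∀ u ∈ ch w, ((((univ.filter fun z : α → Bool =>
        (((¬ (openGraph (labelledOpen ends (fun y => z y && (decide (y = e u) || mQ u y)))).Reachable s w ∧
        ¬ (openGraph (labelledOpen ends (fun y => z y && (decide (y = e u) || mQ u y)))).Reachable s c) ∧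
        (¬ (openGraph (labelledOpen ends (fun y => z y && (decide (y = e u) || mQ u y)))).Reachable c w ∧
        ¬ (openGraph (labelledOpen ends (fun y => z y && (decide (y = e u) || mQ u y)))).Reachable c s)) ∧
        ((¬ (openGraph (labelledOpen ends (fun l =>
          clusterFlip ends w (fun y => !(z y && (decide (y = e u) || mQ u y))) l && (decide (l = e u) || mQ u l)))).Reachable s w ∧
        ¬ (openGraph (labelledOpen ends (fun l =>
          clusterFlip ends w (fun y => !(z y && (decide (y = e u) || mQ u y))) l && (decide (l = e u) || mQ u l)))).Reachable s c) ∧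
        (¬ (openGraph (labelledOpen ends (fun l =>
          clusterFlip ends w (fun y => !(z y && (decide (y = e u) || mQ u y))) l && (decide (l = e u) || mQ u l)))).Reachable c w ∧
        ¬ (openGraph (labelledOpen ends (fun l =>
          clusterFlip ends w (fun y => !(z y && (decide (y = e u) || mQ u y))) l && (decide (l = e u) || mQ u l)))).Reachable c s)))).card) : ℕ) : ℝ) = (((((univ.filter fun z : α → Bool =>
        ((¬ (openGraph (labelledOpen ends (fun y => z y && mQ u y))).Reachable s u ∧
        ¬ (openGraph (labelledOpen ends (fun y => z y && mQ u y))).Reachable s c) ∧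
        (¬ (openGraph (labelledOpen ends (fun y => z y && mQ u y))).Reachable c u ∧
        ¬ (openGraph (labelledOpen ends (fun y => z y && mQ u y))).Reachable c s))).card) : ℕ) : ℝ) + (((univ.filter fun z : α → Bool =>
        (((¬ (openGraph (labelledOpen ends (fun y => z y && mQ u y))).Reachable s u ∧
        ¬ (openGraph (labelledOpen ends (fun y => z y && mQ u y))).Reachable s c) ∧
        (¬ (openGraph (labelledOpen ends (fun y => z y && mQ u y))).Reachable c u ∧
        ¬ (openGraph (labelledOpen ends (fun y => z y && mQ u y))).Reachable c s)) ∧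
        ¬ (openGraph (labelledOpen ends (fun l =>
          clusterFlip ends u (fun y => !(z y && mQ u y)) l && mQ u l))).Reachable c s)).card : ℕ) : ℝ)) / 2 := by
    intro u hu
    obtain ⟨hua, hQu, heQ⟩ := child_hyps (ends := ends) (s := s) (c := c) (T := T) (ch := ch) (mQ := mQ) (Sv := Sv) (e := e) hT hch he hSv1 hSv2 hSv4 w hw u hu
    have h2 := two_mul_card_series_G1_mask ends s w c u (e u) (mQ u) (he w hw u hu) hua (Ne.symm hws) (Ne.symm hwc) hQu heQ
    have h2R := congrArg (fun n : ℕ => (n : ℝ)) h2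
    push_cast at h2R
    linarith
  -- the marks
  have hmS : ∀ m ∈ Ms w, ((((univ.filter fun z : α → Bool =>
        (((¬ (openGraph (labelledOpen ends (fun y => z y && decide (y = m)))).Reachable s w ∧
        ¬ (openGraph (labelledOpen ends (fun y => z y && decide (y = m)))).Reachable s c) ∧
        (¬ (openGraph (labelledOpen ends (fun y => z y && decide (y = m)))).Reachable c w ∧
        ¬ (openGraph (labelledOpen ends (fun y => z y && decide (y = m)))).Reachable c s)) ∧
        ((¬ (openGraph (labelledOpen ends (fun l =>
          clusterFlip ends w (fun y => !(z y && decide (y = m))) l && decide (l = m)))).Reachable s w ∧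
        ¬ (openGraph (labelledOpen ends (fun l =>
          clusterFlip ends w (fun y => !(z y && decide (y = m))) l && decide (l = m)))).Reachable s c) ∧
        (¬ (openGraph (labelledOpen ends (fun l =>
          clusterFlip ends w (fun y => !(z y && decide (y = m))) l && decide (l = m)))).Reachable c w ∧
        ¬ (openGraph (labelledOpen ends (fun l =>
          clusterFlip ends w (fun y => !(z y && decide (y = m))) l && decide (l = m)))).Reachable c s)))).card) : ℕ) : ℝ) = (((univ : Finset (α → Bool)).card : ℝ) / 2) * (0 : ℝ) := by
    intro m hm
    have h2 := two_mul_card_markS_G1 ends s w c m (hMs w hw m hm) (Ne.symm hws) (Ne.symm hwc) hsc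
    have h2R := congrArg (fun n : ℕ => (n : ℝ)) h2
    push_cast at h2R
    linarith
  have hmC : ∀ m ∈ Mc w, ((((univ.filter fun z : α → Bool =>
        (((¬ (openGraph (labelledOpen ends (fun y => z y && decide (y = m)))).Reachable s w ∧
        ¬ (openGraph (labelledOpen ends (fun y => z y && decide (y = m)))).Reachable s c) ∧
        (¬ (openGraph (labelledOpen ends (fun y => z y && decide (y = m)))).Reachable c w ∧
        ¬ (openGraph (labelledOpen ends (fun y => z y && decide (y = m)))).Reachable c s)) ∧
        ((¬ (openGraph (labelledOpen ends (fun l =>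
          clusterFlip ends w (fun y => !(z y && decide (y = m))) l && decide (l = m)))).Reachable s w ∧
        ¬ (openGraph (labelledOpen ends (fun l =>
          clusterFlip ends w (fun y => !(z y && decide (y = m))) l && decide (l = m)))).Reachable s c) ∧
        (¬ (openGraph (labelledOpen ends (fun l =>
          clusterFlip ends w (fun y => !(z y && decide (y = m))) l && decide (l = m)))).Reachable c w ∧
        ¬ (openGraph (labelledOpen ends (fun l =>
          clusterFlip ends w (fun y => !(z y && decide (y = m))) l && decide (l = m)))).Reachable c s)))).card) : ℕ) : ℝ) = (((univ : Finset (α → Bool)).card : ℝ) / 2) * (0 : ℝ) := by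
    intro m hm
    have h2 := two_mul_card_markC_G1 ends s w c m (hMc w hw m hm) (Ne.symm hws) (Ne.symm hwc) hsc
    have h2R := congrArg (fun n : ℕ => (n : ℝ)) h2
    push_cast at h2R
    linarith
  rw [Finset.prod_congr rfl hser, Finset.prod_congr rfl hmS, Finset.prod_congr rfl hmC, Finset.prod_div_distrib,
    Finset.prod_const, Finset.prod_const, Finset.prod_const] at hfamR
  have hU : (0 : ℝ) < ((univ : Finset (α → Bool)).card : ℝ) := by exact_mod_cast Finset.card_pos.mpr Finset.univ_nonempty
  exact assemble_eq' _ _ _ _ _ _ _ _ hU hfamR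

end VertexFlat

end Summit.CriticalPhenomena.PercolationContinuityZ3.Theorems.ProductFormFibre
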